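import Literature.Computability.Complexity.NTIMEPadding
import Literature.Computability.Complexity.CircuitLowerBounds
import HarnessLib

/-!
# The quasi-polynomial witness clock; `NTIME(n^{(log₂ n)ᵉ}) ⊆ NTIME(2^{(log₂ n)^{e+2}}) ⊆ NQP`

Machine-level glue for the Murray–Williams files (`MurrayWilliams2018.lean`,
`MurrayWilliams2018NQP.lean`): Murray–Williams 2018, Thm. 1.3 places its hard languages in
`NTIME[n^{log^e n}]`, whereas the tree's `NQP` (`CircuitLowerBounds.lean`) is the union of the
levels `NTIME (2 ^ (log₂ n) ^ k)`. In the standard model `NTIME[n^{log^e n}] ⊆ NTIME[2^{log^{e+2} n}]`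
is the monotonicity of nondeterministic time in the bound (Arora–Barak 2009, §2.1.2 / Thm. 2.6);
in the tree's one-constant verifier form of `NTIME` (`Nondeterministic.lean`: ONE constant `c`
bounds the admissible witnesses `|y| ≤ c · t |x| + c` AND the time) it is a machine
construction, exactly as the padding translation of `NTIMEPadding.lean`: the new verifier must
cut the witness at EXACTLY `c · t |x| + c` — shorter loses witnesses, longer leaves the given
verifier unspecified — reading the discarded part two symbols per step (`truncMapAux`,
`TruncMapMachine.lean`), which needs a CLOCK machine producing `⟨x, 1^{c · t |x| + c}⟩` in time
`O(t' |x|)`. This file builds the clock for `t n = n ^ (log₂ n) ^ e` (`log₂ = Nat.log 2`):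

* `qpClock c e x = ⟨x, 1^{c · |x|^{(log₂ |x|)ᵉ} + c}⟩` and the structured stack program
  `ExpPad.qpProg c e` over the registers and routines of `ExpPadding.lean` / `NTIMEPadding.lean`
  (`split`, `mulStep`, `powLoop`, `finishClock`) with two new loops: the binary logarithm of a
  unary counter by iterated halving (`ExpPad.halve`, `ExpPad.logLoop`, a genuine while-loop:
  the body refills the loop register with `⌊m/2⌋` tokens) and iterated multiplication driven by
  a unary exponent (`ExpPad.runs_mulLoop`); `ExpPad.runs_qpProg` is the specification with the
  cost `ExpPad.cQP c e n`, and `ExpPad.exists_cQP_le`: `cQP c e n + 1 ≤ C · 2^{(log₂ n)^{e+2}} + C`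
  (every cost term is a polynomial of degree `≤ 3` in `t = n^{(log₂ n)ᵉ}`, and
  `tᵃ ≤ 2^{(log₂ n)^{e+2}}` once `log₂ n ≥ a + 1`, `pow_pow_log_pow_le_add`);
* `exists_qpClock_machine`: a `TM2` machine computing `qpClock c e` within
  `C · 2^{(log₂ |x|)^{e+2}} + C` steps (`ACom.exists_computesInTime`);
* **`NTIME_pow_log_pow_subset_NTIME_two_pow_log_pow`**:
  `NTIME (n ^ (log₂ n) ^ e) ⊆ NTIME (2 ^ (log₂ n) ^ (e + 2))` — the verifier
  `truncMapAux (clock) ∘ (given verifier)`, relation `R x (y ↾ (c · t |x| + c))`;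
* **`NTIME_pow_log_pow_subset_NQP`**: `NTIME (n ^ (log₂ n) ^ e) ⊆ NQP` for every `e` (the
  statement of the glue fact `NTIME_powLog_subset_NQP` of `MurrayWilliams2018NQP.lean`).

## References

* S. Arora, B. Barak, *Computational Complexity: A Modern Approach*, CUP 2009, §2.1.2, Thm. 2.6
  (nondeterministic time; monotonicity is implicit in the NDTM definition), §1.3 (machine
  constructions) [AroraBarak2009].
* C. D. Murray, R. R. Williams, *Circuit lower bounds for nondeterministic quasi-polytime: an easy
  witness lemma for NP and NQP*, STOC 2018, §1.1 (`NQP = NTIME[n^{log^{O(1)} n}]`), Thm. 1.3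
  [MurrayWilliams2018].
* T. Nipkow, G. Klein, *Concrete Semantics with Isabelle/HOL*, Springer 2014, Ch. 7 (big-step
  cost semantics; while-loops by well-founded induction) — the verification style of
  `SymbolPrograms.lean`.
-/

namespace Literature.Computability.Complexity

open _root_.Computability

/-- **The quasi-polynomial witness clock** `qpClock c e x = ⟨x, 1^{c · |x|^{(log₂ |x|)ᵉ} + c}⟩`
(pair code `boolPair`): the admissible witness length of an `NTIME (n ^ (log₂ n) ^ e)` verifier
with constant `c`, in unary, behind the payload `x`. [folklore] -/
def qpClock (c e : ℕ) (x : List Bool) : List Bool :=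
  boolPair x (List.replicate (c * x.length ^ Nat.log 2 x.length ^ e + c) true)

namespace ExpPad

open ACom

/-! ### The binary logarithm of a unary counter by iterated halving -/

/-- Body of `halve` after the loop has popped one token: pop a second token and, if there was
one, account a token on `q`. [folklore] -/
def halveBody : Option Bool → Prog
  | some _ => push .q true
  | none => skip

/-- `halve`: `q := 1^{⌊r/2⌋} ++ q`, `u := []` for `u = 1^r` (consume `u` two tokens at a time).
[folklore] -/
def halve : Prog := loop .u fun _ => pop .u halveBody

/-- Effect and cost of `halve`. [folklore] -/
theorem runs_halve (i xr u2 p q e f o : List Bool) : ∀ r : ℕ,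
    Runs halve (mk i xr (un r) u2 p q e f o) (mk i xr [] u2 p (un (r / 2) ++ q) e f o) (5 * r + 1)
  | 0 => by
    simpa [halve, un] using Runs.loop_nil (k := Rg.u) (fun _ => pop Rg.u halveBody)
      (R := mk i xr [] u2 p q e f o) rfl
  | 1 => by
    have h1 : Runs (pop Rg.u halveBody) (mk i xr [] u2 p q e f o) (mk i xr [] u2 p q e f o) 2 :=
      Runs.pop_nil rfl (Runs.skip _)
    have h2 : Runs (loop Rg.u fun _ => pop Rg.u halveBody) (mk i xr [] u2 p q e f o)
        (mk i xr [] u2 p q e f o) 1 :=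
      Runs.loop_nil (k := Rg.u) (fun _ => pop Rg.u halveBody) rfl
    have := Runs.loop_cons (k := Rg.u) (f := fun _ => pop Rg.u halveBody)
      (R := mk i xr (un 1) u2 p q e f o) (a := true) (w := []) rfl (by simpa using h1) h2
    unfold halve
    exact this.of_eq (by simp [un]) (by norm_num)
  | r + 2 => by
    have h0 : Runs (push Rg.q true) (mk i xr (un r) u2 p q e f o)
        (mk i xr (un r) u2 p (true :: q) e f o) 1 := Runs.push' (by simp)
    have h1 : Runs (pop Rg.u halveBody) (mk i xr (true :: un r) u2 p q e f o)
        (mk i xr (un r) u2 p (true :: q) e f o) (1 + 2) :=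
      Runs.pop_cons (k := Rg.u) (f := halveBody) (a := true) (w := un r) rfl
        (by simpa [halveBody] using h0)
    have h2 := runs_halve i xr u2 p (true :: q) e f o r
    unfold halve at h2
    have := Runs.loop_cons (k := Rg.u) (f := fun _ => pop Rg.u halveBody)
      (R := mk i xr (un (r + 2)) u2 p q e f o) (a := true) (w := true :: un r) rfl
      (by simpa using h1) h2
    unfold halve
    refine this.of_eq ?_ (by omega)
    have e1 : (r + 2) / 2 = r / 2 + 1 := by omega
    simp [un, e1, List.replicate_succ']

/-- Body of the logarithm loop after the loop has popped one token of `u = 1^m`: if `u` is now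
empty (`m = 1`) stop; otherwise (`m ≥ 2`) count one on `u2` and replace the remaining `m - 2`
tokens by `⌊(m-2)/2⌋ + 1 = ⌊m/2⌋` tokens. [folklore] -/
def logBody : Option Bool → Prog
  | none => skip
  | some _ => push .u2 true ;; halve ;; pour .q .u ;; push .u true

/-- `logLoop`: `u2 := 1^{log₂ m} ++ u2`, `u := []` for `u = 1^m` (a while-loop: the body refills
`u` with `⌊m/2⌋` tokens while `m ≥ 2`). [folklore] -/
def logLoop : Prog := loop .u fun _ => pop .u logBody

/-- Effect and cost of `logLoop` (`Nat.log 2 0 = Nat.log 2 1 = 0`), by well-founded induction on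
`m`. [folklore] -/
theorem runs_logLoop (i xr p e f o : List Bool) : ∀ (m L₀ : ℕ),
    Runs logLoop (mk i xr (un m) (un L₀) p [] e f o)
      (mk i xr [] (un (L₀ + Nat.log 2 m)) p [] e f o) (24 * m + 5)
  | 0, L₀ => by
    have h := Runs.loop_nil (k := Rg.u) (fun _ => pop Rg.u logBody)
      (R := mk i xr [] (un L₀) p [] e f o) rfl
    unfold logLoop
    simpa [un] using h.mono (show 1 ≤ 24 * 0 + 5 by norm_num)
  | 1, L₀ => by
    have h1 : Runs (pop Rg.u logBody) (mk i xr [] (un L₀) p [] e f o)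
        (mk i xr [] (un L₀) p [] e f o) 2 := Runs.pop_nil rfl (Runs.skip _)
    have h2 : Runs (loop Rg.u fun _ => pop Rg.u logBody) (mk i xr [] (un L₀) p [] e f o)
        (mk i xr [] (un L₀) p [] e f o) 1 :=
      Runs.loop_nil (k := Rg.u) (fun _ => pop Rg.u logBody) rfl
    have := Runs.loop_cons (k := Rg.u) (f := fun _ => pop Rg.u logBody)
      (R := mk i xr (un 1) (un L₀) p [] e f o) (a := true) (w := []) rfl (by simpa using h1) h2
    unfold logLoop
    exact this.of_eq (by simp [un]) (by norm_num)
  | r + 2, L₀ => by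
    -- the body on `u = 1 :: 1^r`: count, halve, pour back, add one
    have ha : Runs (push Rg.u2 true) (mk i xr (un r) (un L₀) p [] e f o)
        (mk i xr (un r) (un (L₀ + 1)) p [] e f o) 1 :=
      Runs.push' (by simp [un, List.replicate_succ])
    have hb := runs_halve i xr (un (L₀ + 1)) p [] e f o r
    simp only [List.append_nil] at hb
    have hc := runs_pour (Γ := Bool) (a := Rg.q) (b := Rg.u) (by decide)
      (mk i xr [] (un (L₀ + 1)) p (un (r / 2)) e f o)
    have hc' : Runs (pour Rg.q Rg.u) (mk i xr [] (un (L₀ + 1)) p (un (r / 2)) e f o)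
        (mk i xr (un (r / 2)) (un (L₀ + 1)) p [] e f o) (3 * (r / 2) + 1) := by
      simpa [un] using hc
    have hd : Runs (push Rg.u true) (mk i xr (un (r / 2)) (un (L₀ + 1)) p [] e f o)
        (mk i xr (un (r / 2 + 1)) (un (L₀ + 1)) p [] e f o) 1 :=
      Runs.push' (by simp [un, List.replicate_succ])
    have hbody := ha.seq (hb.seq (hc'.seq hd))
    have h1 : Runs (pop Rg.u logBody) (mk i xr (true :: un r) (un L₀) p [] e f o)
        (mk i xr (un (r / 2 + 1)) (un (L₀ + 1)) p [] e f o)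
        ((1 + (5 * r + 1 + (3 * (r / 2) + 1 + 1))) + 2) :=
      Runs.pop_cons (k := Rg.u) (f := logBody) (a := true) (w := un r) rfl
        (by simpa [logBody] using hbody)
    -- the rest of the loop, on `⌊m/2⌋ = ⌊r/2⌋ + 1 < m`
    have h2 := runs_logLoop i xr p e f o (r / 2 + 1) (L₀ + 1)
    unfold logLoop at h2
    have := Runs.loop_cons (k := Rg.u) (f := fun _ => pop Rg.u logBody)
      (R := mk i xr (un (r + 2)) (un L₀) p [] e f o) (a := true) (w := true :: un r) rfl
      (by simpa using h1) h2
    unfold logLoop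
    refine this.of_eq ?_ (by omega)
    have hlog : Nat.log 2 (r + 2) = Nat.log 2 (r / 2 + 1) + 1 := by
      rw [Nat.log_of_one_lt_of_le one_lt_two (by omega : 2 ≤ r + 2)]
      congr 2
      omega
    have hsum : L₀ + 1 + Nat.log 2 (r / 2 + 1) = L₀ + Nat.log 2 (r + 2) := by
      rw [hlog]; ring
    rw [hsum]

/-! ### Iterated multiplication driven by a unary exponent -/

/-- Cost of the multiplication loop: `P` steps `p := p · n` starting from `p = 1^a`. [folklore] -/
def cMul (n : ℕ) : ℕ → ℕ → ℕ
  | 0, _ => 1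
  | P + 1, a => (7 * n + 4) * a + 3 * (a * n) + 2 + 2 + cMul n P (a * n)

/-- Effect and cost of the multiplication loop `loop f mulStep`: for `u = 1ⁿ`, `p = 1^a`,
`f = 1^P`: `p := 1^{a nᴾ}`, `f := []`. [folklore] -/
theorem runs_mulLoop (i xr o : List Bool) (n : ℕ) : ∀ (P a : ℕ),
    Runs (loop .f fun _ => mulStep) (mk i xr (un n) [] (un a) [] [] (un P) o)
      (mk i xr (un n) [] (un (a * n ^ P)) [] [] [] o) (cMul n P a)
  | 0, a => by
    simpa [cMul, un] using Runs.loop_nil (k := Rg.f) (fun _ => mulStep)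
      (R := mk i xr (un n) [] (un a) [] [] [] o) rfl
  | P + 1, a => by
    have h1 := runs_mulStep i xr [] (un P) o n a
    have h2 := runs_mulLoop i xr o n P (a * n)
    rw [show a * n * n ^ P = a * n ^ (P + 1) by ring] at h2
    have := Runs.loop_cons (k := Rg.f) (f := fun _ => mulStep)
      (R := mk i xr (un n) [] (un a) [] [] (un (P + 1)) o) (a := true) (w := un P) rfl
      (by simpa using h1) h2
    exact this.of_eq rfl (by simp [cMul])

/-- `n P ≤ n^{P+1} + P` (for `n ≥ 2`, `P ≤ nᴾ`). [folklore] -/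
theorem mul_le_pow_succ_add (n P : ℕ) : n * P ≤ n ^ (P + 1) + P := by
  rcases Nat.lt_or_ge n 2 with hn | hn
  · interval_cases n <;> simp
  · have hP : P ≤ n ^ P := (Nat.lt_two_pow_self).le.trans (Nat.pow_le_pow_left hn P)
    calc n * P ≤ n * n ^ P := Nat.mul_le_mul_left n hP
      _ = n ^ (P + 1) := by ring
      _ ≤ _ := Nat.le_add_right _ _

/-- Closed bound for the cost of the multiplication loop:
`cMul n P a ≤ (10 n + 4) a P (nᴾ + 1) + 4 P + 1`. [folklore] -/
theorem cMul_le (n : ℕ) : ∀ P a : ℕ,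
    cMul n P a ≤ (10 * n + 4) * a * (P * (n ^ P + 1)) + 4 * P + 1
  | 0, a => by simp [cMul]
  | P + 1, a => by
    have ih := cMul_le n P (a * n)
    have key := mul_le_pow_succ_add n P
    have hA : (10 * n + 4) * a * (1 + n * (P * (n ^ P + 1))) ≤
        (10 * n + 4) * a * ((P + 1) * (n ^ (P + 1) + 1)) := by
      refine Nat.mul_le_mul_left _ ?_
      have e1 : (P + 1) * (n ^ (P + 1) + 1) = P * n ^ (P + 1) + P + (n ^ (P + 1) + 1) := by ring
      have e2 : 1 + n * (P * (n ^ P + 1)) = P * n ^ (P + 1) + n * P + 1 := by ring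
      rw [e1, e2]
      omega
    have e3 : (7 * n + 4) * a + 3 * (a * n) = (10 * n + 4) * a := by ring
    have e4 : (10 * n + 4) * (a * n) * (P * (n ^ P + 1)) =
        (10 * n + 4) * a * (n * (P * (n ^ P + 1))) := by ring
    calc cMul n (P + 1) a
        = (7 * n + 4) * a + 3 * (a * n) + 2 + 2 + cMul n P (a * n) := rfl
      _ ≤ (10 * n + 4) * a + 4 + ((10 * n + 4) * (a * n) * (P * (n ^ P + 1)) + 4 * P + 1) := by
          rw [← e3]; omega
      _ = (10 * n + 4) * a * (1 + n * (P * (n ^ P + 1))) + 4 * (P + 1) + 1 := by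
          rw [e4]; ring
      _ ≤ (10 * n + 4) * a * ((P + 1) * (n ^ (P + 1) + 1)) + 4 * (P + 1) + 1 :=
          Nat.add_le_add_right (Nat.add_le_add_right hA _) _

/-! ### The whole clock program -/

/-- **The quasi-polynomial clock program**: split the input (`xr := x⁻¹`, `u := 1ⁿ`), save `1ⁿ`
in `e`, `u2 := 1^{log₂ n}` by `logLoop`, `p := 1^{(log₂ n)ᵉ}` by `powLoop e` on the base
`u := 1^{log₂ n}`, move it to `f`, restore `u := 1ⁿ`, `p := 1^{n^{(log₂ n)ᵉ}}` by the
multiplication loop, move it to `e`, and write `⟨x, 1^{c · n^{(log₂ n)ᵉ} + c}⟩`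
(`finishClock c`). [folklore] -/
def qpProg (c e : ℕ) : Prog :=
  split ;; copy2 .u .e .f ;; pour .f .u ;; logLoop ;; pour .u2 .u ;; push .p true ;; powLoop e ;;
    pour .p .f ;; clear .u ;; pour .e .u ;; push .p true ;; (loop .f fun _ => mulStep) ;;
    pour .p .e ;; finishClock c

/-- Cost of the clock program on inputs of length `n` (`L = log₂ n`, `P = Lᵉ`, `t = nᴾ`).
[folklore] -/
def cQP (c e n : ℕ) : ℕ :=
  (4 * n + 1) + (4 * n + 1) + (3 * n + 1) + (24 * n + 5) + (3 * Nat.log 2 n + 1) + 1 +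
    cPow (Nat.log 2 n) e + (3 * Nat.log 2 n ^ e + 1) + (2 * Nat.log 2 n + 1) + (3 * n + 1) + 1 +
    cMul n (Nat.log 2 n ^ e) 1 + (3 * n ^ Nat.log 2 n ^ e + 1) +
    (((c + 2) * n ^ Nat.log 2 n ^ e + 1) + c + 1 + 1 + (4 * n + 1) + (2 * n + 1))

/-- **Effect and cost of the clock program**: from the input store holding `x` to the output
store holding `qpClock c e x`, within `cQP c e |x|` steps. [folklore] -/
theorem runs_qpProg (c e : ℕ) (x : List Bool) :
    Runs (qpProg c e) (AStore.single .inp x) (AStore.single .out (qpClock c e x))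
      (cQP c e x.length) := by
  rw [single_inp, single_out]
  unfold qpProg cQP qpClock
  set n := x.length with hn
  set L := Nat.log 2 n with hL
  set P := L ^ e with hP
  set t := n ^ P with ht
  have h1 := runs_split x
  rw [← hn] at h1
  have h2 := runs_copy2 (Γ := Bool) (a := Rg.u) (b := Rg.e) (c := Rg.f) (by decide) (by decide)
    (by decide) (mk [] x.reverse (un n) [] [] [] [] [] [])
  have h2' : Runs (copy2 Rg.u Rg.e Rg.f) (mk [] x.reverse (un n) [] [] [] [] [] [])
      (mk [] x.reverse [] [] [] [] (un n) (un n) []) (4 * n + 1) := by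
    simpa [un] using h2
  have h3 := runs_pour (Γ := Bool) (a := Rg.f) (b := Rg.u) (by decide)
    (mk [] x.reverse [] [] [] [] (un n) (un n) [])
  have h3' : Runs (pour Rg.f Rg.u) (mk [] x.reverse [] [] [] [] (un n) (un n) [])
      (mk [] x.reverse (un n) [] [] [] (un n) [] []) (3 * n + 1) := by
    simpa [un] using h3
  have h4 := runs_logLoop [] x.reverse [] (un n) [] [] n 0
  rw [Nat.zero_add, ← hL] at h4
  have h4' : Runs logLoop (mk [] x.reverse (un n) [] [] [] (un n) [] [])
      (mk [] x.reverse [] (un L) [] [] (un n) [] []) (24 * n + 5) := by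
    simpa [un] using h4
  have h5 := runs_pour (Γ := Bool) (a := Rg.u2) (b := Rg.u) (by decide)
    (mk [] x.reverse [] (un L) [] [] (un n) [] [])
  have h5' : Runs (pour Rg.u2 Rg.u) (mk [] x.reverse [] (un L) [] [] (un n) [] [])
      (mk [] x.reverse (un L) [] [] [] (un n) [] []) (3 * L + 1) := by
    simpa [un] using h5
  have h6 : Runs (push Rg.p true) (mk [] x.reverse (un L) [] [] [] (un n) [] [])
      (mk [] x.reverse (un L) [] (un 1) [] (un n) [] []) 1 := Runs.push' (by simp [un])
  have h7 := runs_powLoop [] x.reverse (un n) [] [] L e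
  rw [← hP] at h7
  have h8 := runs_pour (Γ := Bool) (a := Rg.p) (b := Rg.f) (by decide)
    (mk [] x.reverse (un L) [] (un P) [] (un n) [] [])
  have h8' : Runs (pour Rg.p Rg.f) (mk [] x.reverse (un L) [] (un P) [] (un n) [] [])
      (mk [] x.reverse (un L) [] [] [] (un n) (un P) []) (3 * P + 1) := by
    simpa [un] using h8
  have h9 := runs_clear (Γ := Bool) Rg.u (mk [] x.reverse (un L) [] [] [] (un n) (un P) [])
  have h9' : Runs (clear Rg.u) (mk [] x.reverse (un L) [] [] [] (un n) (un P) [])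
      (mk [] x.reverse [] [] [] [] (un n) (un P) []) (2 * L + 1) := by
    simpa [un] using h9
  have h10 := runs_pour (Γ := Bool) (a := Rg.e) (b := Rg.u) (by decide)
    (mk [] x.reverse [] [] [] [] (un n) (un P) [])
  have h10' : Runs (pour Rg.e Rg.u) (mk [] x.reverse [] [] [] [] (un n) (un P) [])
      (mk [] x.reverse (un n) [] [] [] [] (un P) []) (3 * n + 1) := by
    simpa [un] using h10
  have h11 : Runs (push Rg.p true) (mk [] x.reverse (un n) [] [] [] [] (un P) [])
      (mk [] x.reverse (un n) [] (un 1) [] [] (un P) []) 1 := Runs.push' (by simp [un])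
  have h12 := runs_mulLoop [] x.reverse [] n P 1
  rw [one_mul, ← ht] at h12
  have h13 := runs_pour (Γ := Bool) (a := Rg.p) (b := Rg.e) (by decide)
    (mk [] x.reverse (un n) [] (un t) [] [] [] [])
  have h13' : Runs (pour Rg.p Rg.e) (mk [] x.reverse (un n) [] (un t) [] [] [] [])
      (mk [] x.reverse (un n) [] [] [] (un t) [] []) (3 * t + 1) := by
    simpa [un] using h13
  have h14 := runs_finishClock c x n t
  rw [← hn] at h14
  have := h1.seq (h2'.seq (h3'.seq (h4'.seq (h5'.seq (h6.seq (h7.seq (h8'.seq (h9'.seq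
    (h10'.seq (h11.seq (h12.seq (h13'.seq h14))))))))))))
  exact this.of_eq (by simp [un]) (by omega)

/-! ### The time bound -/

/-- **Powers of `n^{(log₂ n)ᵉ}` against `2^{(log₂ n)^{e+2}}`**: `(n^{(log₂ n)ᵉ})ᵃ ≤
2^{(log₂ n)^{e+2}} + (2^{a+1})^{(a+1)ᵉ a}` (for `log₂ n ≥ a + 1` one has `n < 2^{log₂ n + 1}` and
`a (log₂ n + 1) ≤ (log₂ n)²`; smaller `n < 2^{a+1}` are absorbed by the constant). [folklore] -/
theorem pow_pow_log_pow_le_add (e a n : ℕ) :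
    (n ^ Nat.log 2 n ^ e) ^ a ≤ 2 ^ Nat.log 2 n ^ (e + 2) + (2 ^ (a + 1)) ^ ((a + 1) ^ e * a) := by
  set L := Nat.log 2 n with hL
  by_cases h : 2 ^ (a + 1) ≤ n
  · have hn0 : n ≠ 0 := Nat.pos_iff_ne_zero.mp (lt_of_lt_of_le (Nat.two_pow_pos _) h)
    have haL : a + 1 ≤ L := (Nat.le_log_iff_pow_le one_lt_two hn0).mpr h
    have hle : n ≤ 2 ^ (L + 1) := (Nat.lt_pow_succ_log_self one_lt_two n).le
    have hexp : (L + 1) * L ^ e * a ≤ L ^ (e + 2) := by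
      have h1 : (L + 1) * a ≤ L * L := by nlinarith
      calc (L + 1) * L ^ e * a = ((L + 1) * a) * L ^ e := by ring
        _ ≤ (L * L) * L ^ e := Nat.mul_le_mul_right _ h1
        _ = L ^ (e + 2) := by ring
    calc (n ^ L ^ e) ^ a ≤ ((2 ^ (L + 1)) ^ L ^ e) ^ a := by gcongr
      _ = 2 ^ ((L + 1) * L ^ e * a) := by rw [← pow_mul, ← pow_mul, Nat.mul_assoc]
      _ ≤ 2 ^ L ^ (e + 2) := Nat.pow_le_pow_right two_pos hexp
      _ ≤ _ := Nat.le_add_right _ _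
  · have hn : n ≤ 2 ^ (a + 1) := Nat.le_of_not_le h
    have hLa : L ≤ a + 1 :=
      (Nat.log_lt_of_lt_pow' (Nat.succ_ne_zero a) (Nat.lt_of_not_le h)).le
    calc (n ^ L ^ e) ^ a ≤ ((2 ^ (a + 1)) ^ L ^ e) ^ a := by gcongr
      _ = (2 ^ (a + 1)) ^ (L ^ e * a) := by rw [← pow_mul]
      _ ≤ (2 ^ (a + 1)) ^ ((a + 1) ^ e * a) := by
          refine Nat.pow_le_pow_right (by positivity) ?_
          gcongr
      _ ≤ _ := Nat.le_add_left _ _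

/-- The size quantities of the program against `t = n^{(log₂ n)ᵉ}`: `n ≤ t`, `log₂ n ≤ t` and
`(log₂ n)ᵉ ≤ t + 1`. [folklore] -/
theorem sizes_le_pow_pow_log (e n : ℕ) :
    n ≤ n ^ Nat.log 2 n ^ e ∧ Nat.log 2 n ≤ n ^ Nat.log 2 n ^ e ∧
      Nat.log 2 n ^ e ≤ n ^ Nat.log 2 n ^ e + 1 := by
  set L := Nat.log 2 n with hL
  rcases Nat.lt_or_ge n 2 with hn | hn
  · have hL0 : L = 0 := by
      rw [hL]; interval_cases n <;> simp
    rw [hL0]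
    rcases Nat.eq_zero_or_pos e with rfl | he
    · simp only [pow_zero, pow_one]; omega
    · rw [zero_pow he.ne', pow_zero]; omega
  · have hL1 : 1 ≤ L := (Nat.le_log_iff_pow_le one_lt_two (by omega)).mpr (by simpa using hn)
    have hP1 : 1 ≤ L ^ e := Nat.one_le_pow _ _ hL1
    have hn' : n ≤ n ^ L ^ e := by
      calc n = n ^ 1 := (pow_one n).symm
        _ ≤ n ^ L ^ e := Nat.pow_le_pow_right (by omega) hP1
    have hPt : L ^ e ≤ n ^ L ^ e :=
      (Nat.lt_two_pow_self).le.trans (Nat.pow_le_pow_left hn _)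
    exact ⟨hn', (Nat.log_le_self 2 n).trans hn', hPt.trans (Nat.le_succ _)⟩

/-- **The clock program runs in time `O(2^{(log₂ n)^{e+2}})`**: `cQP c e n + 1 ≤
C · 2^{(log₂ n)^{e+2}} + C` for a constant `C` depending on `c` and `e` (all stages cost a
polynomial of degree `≤ 3` in `t = n^{(log₂ n)ᵉ}`, the power stage a polynomial in `log₂ n`).
[folklore] -/
theorem exists_cQP_le (c e : ℕ) :
    ∃ C : ℕ, ∀ n : ℕ, cQP c e n + 1 ≤ C * 2 ^ Nat.log 2 n ^ (e + 2) + C := by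
  open Polynomial in
  obtain ⟨c₀, hc₀⟩ := TimeConstructible.exists_poly_le_two_pow_pow (cPowPoly e) (k := e + 2)
    (by omega)
  refine ⟨(2 * c + 200) * (c₀ + 8 * (2 ^ (3 + 1)) ^ ((3 + 1) ^ e * 3) + 16), fun n => ?_⟩
  have hA3 := pow_pow_log_pow_le_add e 3 n
  obtain ⟨hn, hLt, hPt⟩ := sizes_le_pow_pow_log e n
  set D₃ := (2 ^ (3 + 1)) ^ ((3 + 1) ^ e * 3) with hD₃
  set L := Nat.log 2 n with hL
  set P := L ^ e with hP
  set t := n ^ P with ht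
  set M := 2 ^ L ^ (e + 2) with hM
  have hpow : cPow L e ≤ c₀ * M + c₀ := by rw [← eval_cPowPoly]; exact hc₀ L
  have hmul : cMul n P 1 ≤ 10 * (t + 1) ^ 3 + 4 * t + 5 := by
    have h := cMul_le n P 1
    rw [← ht] at h
    have h2 : (10 * n + 4) * 1 * (P * (t + 1)) ≤ 10 * (t + 1) ^ 3 := by
      calc (10 * n + 4) * 1 * (P * (t + 1)) ≤ (10 * (t + 1)) * ((t + 1) * (t + 1)) :=
            Nat.mul_le_mul (by omega) (Nat.mul_le_mul_right _ hPt)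
        _ = 10 * (t + 1) ^ 3 := by ring
    calc cMul n P 1 ≤ (10 * n + 4) * 1 * (P * (t + 1)) + 4 * P + 1 := h
      _ ≤ 10 * (t + 1) ^ 3 + 4 * P + 1 := by gcongr
      _ ≤ 10 * (t + 1) ^ 3 + 4 * t + 5 := by omega
  have hcube : (t + 1) ^ 3 ≤ 8 * t ^ 3 + 8 := by
    rcases Nat.eq_zero_or_pos t with h0 | h1
    · rw [h0]; norm_num
    · have h2 : t + 1 ≤ 2 * t := by omega
      calc (t + 1) ^ 3 ≤ (2 * t) ^ 3 := Nat.pow_le_pow_left h2 3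
        _ = 8 * t ^ 3 := by ring
        _ ≤ 8 * t ^ 3 + 8 := Nat.le_add_right _ _
  -- every term of `cQP` against `(t + 1)^3`, `t` and `cPow`
  have hsum : cQP c e n + 1 ≤ (2 * c + 200) * ((t + 1) ^ 3 + cPow L e) := by
    have h3 : 1 ≤ (t + 1) ^ 3 := Nat.one_le_pow _ _ (Nat.succ_pos t)
    have h4 : t ≤ (t + 1) ^ 3 := by
      calc t ≤ t + 1 := Nat.le_succ t
        _ = (t + 1) ^ 1 := (pow_one _).symm
        _ ≤ (t + 1) ^ 3 := Nat.pow_le_pow_right (Nat.succ_pos t) (by norm_num)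
    have h5 : c * t ≤ c * (t + 1) ^ 3 := Nat.mul_le_mul_left c h4
    unfold cQP
    rw [← hL, ← hP, ← ht]
    nlinarith [hn, hLt, hPt, hmul, h3, h4, h5]
  have hB : (t + 1) ^ 3 + cPow L e ≤ (8 * (M + D₃) + 8) + (c₀ * M + c₀) := by
    have hB1 : (t + 1) ^ 3 ≤ 8 * (M + D₃) + 8 := hcube.trans (by omega)
    exact Nat.add_le_add hB1 hpow
  calc cQP c e n + 1 ≤ (2 * c + 200) * ((t + 1) ^ 3 + cPow L e) := hsum
    _ ≤ (2 * c + 200) * ((8 * (M + D₃) + 8) + (c₀ * M + c₀)) := Nat.mul_le_mul_left _ hB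
    _ = (2 * c + 200) * (8 + c₀) * M + (2 * c + 200) * (8 * D₃ + 8 + c₀) := by ring
    _ ≤ (2 * c + 200) * (c₀ + 8 * D₃ + 16) * M + (2 * c + 200) * (c₀ + 8 * D₃ + 16) :=
        Nat.add_le_add (Nat.mul_le_mul_right _ (Nat.mul_le_mul_left _ (by omega)))
          (Nat.mul_le_mul_left _ (by omega))

end ExpPad

/-! ### The clock is computable in quasi-polynomial time -/

open ExpPad in
/-- **The quasi-polynomial clock is computed by a multi-stack machine within
`C · 2^{(log₂ |x|)^{e+2}} + C` steps** (the structured program `ExpPad.qpProg c e` compiled by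
`ACom.exists_computesInTime`, and `ExpPad.exists_cQP_le`). [folklore] -/
theorem exists_qpClock_machine (c e : ℕ) :
    ∃ (C : ℕ) (N : Turing.TM2ComputableAux Bool Bool), ∀ x : List Bool,
      N.OutputsWithin x (qpClock c e x) (C * 2 ^ Nat.log 2 x.length ^ (e + 2) + C) := by
  obtain ⟨C, hC⟩ := ExpPad.exists_cQP_le c e
  obtain ⟨M, hM⟩ := ACom.exists_computesInTime (qpProg c e) .inp .out id id (qpClock c e)
    (fun x => cQP c e x.length) (runs_qpProg c e)
  exact ⟨C, M, fun x => (hM x).mono (hC x.length)⟩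

/-! ### `NTIME(n^{(log₂ n)ᵉ}) ⊆ NTIME(2^{(log₂ n)^{e+2}}) ⊆ NQP` -/

/-- `2^{(log₂ n)²} ≤ 2^{(log₂ n)^{e+2}}`. [folklore] -/
theorem two_pow_log_sq_le (e n : ℕ) : 2 ^ Nat.log 2 n ^ 2 ≤ 2 ^ Nat.log 2 n ^ (e + 2) := by
  refine Nat.pow_le_pow_right two_pos ?_
  rcases Nat.eq_zero_or_pos (Nat.log 2 n) with h | h
  · simp [h]
  · exact Nat.pow_le_pow_right h (by omega)

/-- `n ≤ 2^{(log₂ n)^{e+2}} + 4`. [folklore] -/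
theorem le_two_pow_log_pow_add (e n : ℕ) : n ≤ 2 ^ Nat.log 2 n ^ (e + 2) + 4 := by
  have h := ExpPad.pow_pow_log_pow_le_add 0 1 n
  have h' : n ≤ 2 ^ Nat.log 2 n ^ 2 + 4 := by simpa using h
  have h2 := two_pow_log_sq_le e n
  omega

/-- **`NTIME (n ^ (log₂ n) ^ e) ⊆ NTIME (2 ^ (log₂ n) ^ (e + 2))`** (monotonicity of
nondeterministic time, Arora–Barak 2009, §2.1.2 / Thm. 2.6, in the tree's verifier form). Given
a verifier `(c, R, M)` of `L` for the bound `t n = n ^ (log₂ n) ^ e`, the new verifier on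
`⟨x, y⟩` is the truncating wrapper `truncMapAux` of the clock `x ↦ qpClock c e x` — output
`⟨x, y ↾ (c · t |x| + c)⟩`, the discarded part of `y` read two symbols per step — followed by
`M`; the relation `R x (y ↾ (c · t |x| + c))` has the same witnesses as `R x` inside the
admissible range, and everything runs in time `O(2^{(log₂ |x|)^{e+2}}) + |y| / 2` since
`c · t n + c ≤ c · 2^{(log₂ n)^{e+2}} + O(1)`. [cite: AroraBarak2009, §2.1.2 and Thm. 2.6] -/
theorem NTIME_pow_log_pow_subset_NTIME_two_pow_log_pow (e : ℕ) :
    NTIME (fun n => n ^ Nat.log 2 n ^ e) ⊆ NTIME (fun n => 2 ^ Nat.log 2 n ^ (e + 2)) := by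
  intro L hL
  obtain ⟨c, R, M, hM, hLR⟩ := hL
  obtain ⟨C, Nc, hNc⟩ := exists_qpClock_machine c e
  set D₁ := (2 ^ (1 + 1)) ^ ((1 + 1) ^ e * 1) with hD₁
  have hA1 : ∀ n : ℕ, c * n ^ Nat.log 2 n ^ e ≤ c * 2 ^ Nat.log 2 n ^ (e + 2) + c * D₁ := by
    intro n
    have h : n ^ Nat.log 2 n ^ e ≤ 2 ^ Nat.log 2 n ^ (e + 2) + D₁ := by
      simpa [hD₁] using ExpPad.pow_pow_log_pow_le_add e 1 n
    calc c * n ^ Nat.log 2 n ^ e ≤ c * (2 ^ Nat.log 2 n ^ (e + 2) + D₁) := Nat.mul_le_mul_left c h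
      _ = _ := Nat.mul_add c _ _
  -- the verifier and its constant (kept opaque: only the two linear facts below are used)
  let V : Turing.TM2ComputableAux Bool Bool := (truncMapAux Nc).comp M
  let B : ℕ → ℕ := fun n => c * n ^ Nat.log 2 n ^ e + c
  obtain ⟨K, hK⟩ : ∃ K : ℕ, K = 3 * (c * D₁) + 3 * c + C + 31 := ⟨_, rfl⟩
  refine ⟨2 * K + 2, fun x y => R x (y.take (B x.length)), V, fun x y hy => ?_, fun x => ?_⟩
  · -- running time
    set n := x.length with hn
    have h₁ := outputsWithin_truncMapAux_boolPair Nc (y := y) (hNc x)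
    simp only [List.length_replicate, ← hn] at h₁
    have hy' : (y.take (B n)).length ≤ c * n ^ Nat.log 2 n ^ e + c := List.length_take_le _ _
    have h₂ : M.OutputsWithin (boolPair x (y.take (B n))) (encodeBool (R x (y.take (B n))))
        (c * n ^ Nat.log 2 n ^ e + c) := by
      have := hM x (y.take (B n)) hy'
      rwa [← hn] at this
    have h := Turing.TM2ComputableAux.comp_outputsWithin _ _ h₁ h₂
    refine h.mono ?_
    dsimp only
    -- the estimates
    have e1 := hA1 n
    have hnT : n ≤ 2 ^ Nat.log 2 n ^ (e + 2) + 4 := le_two_pow_log_pow_add e n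
    have hy2 : 2 * (y.length / 2) ≤ (2 * K + 2) * 2 ^ Nat.log 2 n ^ (e + 2) + (2 * K + 2) :=
      (Nat.mul_div_le y.length 2).trans hy
    have hKT : (3 * c + C + 5) * 2 ^ Nat.log 2 n ^ (e + 2) + (3 * (c * D₁) + 3 * c + C + 31) ≤
        K * 2 ^ Nat.log 2 n ^ (e + 2) + K :=
      Nat.add_le_add (Nat.mul_le_mul_right _ (by omega)) (by omega)
    have hT1 : 1 ≤ 2 ^ Nat.log 2 n ^ (e + 2) := Nat.one_le_two_pow
    linarith [e1, hnT, hy2, hKT, hT1]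
  · -- correctness
    rw [hLR x]
    set n := x.length with hn
    constructor
    · rintro ⟨y₀, hy₀, hR⟩
      dsimp only at hy₀
      refine ⟨y₀, ?_, ?_⟩
      · dsimp only
        have e1 := hA1 n
        have hK2 : c * 2 ^ Nat.log 2 n ^ (e + 2) + (c * D₁ + c) ≤
            (2 * K + 2) * 2 ^ Nat.log 2 n ^ (e + 2) + (2 * K + 2) :=
          Nat.add_le_add (Nat.mul_le_mul_right _ (by omega)) (by omega)
        linarith [e1, hy₀, hK2]
      · change R x (y₀.take (c * n ^ Nat.log 2 n ^ e + c)) = true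
        rwa [List.take_of_length_le hy₀]
    · rintro ⟨y, -, hR⟩
      exact ⟨y.take (B n), List.length_take_le _ _, hR⟩

/-- **`NTIME (n ^ (log₂ n) ^ e) ⊆ NQP`** for every `e` (through the level `e + 2` of `NQP`): the
statement of the glue fact `NTIME_powLog_subset_NQP` of `MurrayWilliams2018NQP.lean`, by which
the hard languages of Murray–Williams 2018, Thm. 1.3 (`NTIME[n^{log^e n}]`) lie in
`NQP = ⋃ₖ NTIME (2 ^ (log₂ n) ^ k)`. [cite: MurrayWilliams2018, §1.1 and Thm. 1.3] -/
theorem NTIME_pow_log_pow_subset_NQP (e : ℕ) : NTIME (fun n => n ^ Nat.log 2 n ^ e) ⊆ NQP :=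
  (NTIME_pow_log_pow_subset_NTIME_two_pow_log_pow e).trans (NTIME_quasipoly_subset_NQP (e + 2))

end Literature.Computability.Complexity
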